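import Literature.Barriers.RiemannHypothesis.BeurlingCounterexamples
import Literature.NumberTheory.BeurlingPrimes.MergePowers
import Mathlib.Data.Finsupp.Interval
import HarnessLib

/-!
# Generalized integers and the Chebyshev function of a Beurling system: finiteness, monotonicity, jumps

Topic `Literature/NumberTheory/BeurlingPrimes`. Everything in this file is PROVED; it is elementary
infrastructure for the `[α, β]`-systems of Hilberdink 2005 / Broucke–Debruyne–Révész 2023
(`Literature.Barriers.RiemannHypothesis.BeurlingPrimes.IsSystem`), used to discharge the glue between
the named facts of `WellBehavedSystems.lean`.

For a Beurling prime system `P` (`1 < λ₀ ≤ λ₁ ≤ …`, `λ_j → ∞`; barrier file `BeurlingCounterexamples`):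
* `finite_setOf_genInt_le` — only finitely many exponent vectors `k` have `∏ λ_j^{k_j} ≤ x`, so
  `N_P(x) = intCount x` is an honest finite count (`intCount_eq_ncard`), monotone (`intCount_mono`), `≥ 1` on
  `x ≥ 1`, and it jumps by at least one at every generalized integer (`intCount_lt_intCount_genInt`);
* `log_prime_le_chebyshevPsi_sub` — `ψ_P` (a finite sum, non-negative and monotone: tree, `MergePowers.lean`)
  jumps by `log λ_j ≥ log λ₀` at every prime `λ_j`;
* consequences for the error classes of the barrier file: `IntErrorLE a γ` and `PrimeErrorLE γ` are monotone
  in the exponent (`IntErrorLE.of_le`, `PrimeErrorLE.of_le`) and FAIL for every negative exponent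
  (`not_intErrorLE_of_neg`, `not_primeErrorLE_of_neg`): a step function cannot stay within `o(1)` of the
  continuous functions `ax`, `x` across its jumps. In particular "for no `ε < 0`" is automatic at exponent `0`.

## References
* [BrouckeDebruyneRevesz2023] F. Broucke, G. Debruyne, Sz. Gy. Révész, *Some examples of well-behaved Beurling
  number systems*, arXiv:2309.01567, §1 (generalized integers counted by factorisation; `ψ_𝒫`, `N_𝒫`).
* [DiamondMontgomeryVorhauer2006] H. G. Diamond, H. L. Montgomery, U. M. A. Vorhauer, *Beurling primes with large
  oscillation*, Math. Ann. 334 (2006) 1–36, §1.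
-/

noncomputable section

open Filter Set
open scoped Topology

namespace Literature.NumberTheory.BeurlingPrimes

open Literature.Barriers.RiemannHypothesis

variable (P : BeurlingPrimes)

/-! ### Exponent vectors of bounded generalized integers -/

/-- `λ_j^{k_j} ≤ ∏_i λ_i^{k_i}` (all factors are `≥ 1`). [folklore] -/
theorem _root_.Literature.Barriers.RiemannHypothesis.BeurlingPrimes.prime_pow_le_genInt (k : ℕ →₀ ℕ) (j : ℕ) :
    P.prime j ^ k j ≤ P.genInt k := by
  by_cases hj : j ∈ k.support
  · unfold BeurlingPrimes.genInt Finsupp.prod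
    rw [Finset.prod_eq_mul_prod_sdiff_singleton_of_mem hj]
    refine le_mul_of_one_le_right (pow_nonneg (P.prime_pos j).le _) ?_
    exact Finset.one_le_prod fun i _ ↦ one_le_pow₀ (P.one_lt_prime i).le
  · rw [Finsupp.notMem_support_iff.mp hj, pow_zero]
    exact P.one_le_genInt k

/-- If `∏ λ_i^{k_i} ≤ x` and `k_j ≠ 0` then `λ_j ≤ x`. [folklore] -/
theorem _root_.Literature.Barriers.RiemannHypothesis.BeurlingPrimes.prime_le_of_genInt_le {k : ℕ →₀ ℕ} {x : ℝ}
    (h : P.genInt k ≤ x) {j : ℕ} (hj : k j ≠ 0) : P.prime j ≤ x := by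
  have h1 : P.prime j ^ 1 ≤ P.prime j ^ k j :=
    pow_le_pow_right₀ (P.one_lt_prime j).le (Nat.one_le_iff_ne_zero.mpr hj)
  rw [pow_one] at h1
  exact h1.trans ((P.prime_pow_le_genInt k j).trans h)

/-- If `∏ λ_i^{k_i} ≤ x < λ₀^B` then every exponent is `< B`. [folklore] -/
theorem _root_.Literature.Barriers.RiemannHypothesis.BeurlingPrimes.apply_lt_of_genInt_le {k : ℕ →₀ ℕ} {x : ℝ}
    {B : ℕ} (h : P.genInt k ≤ x) (hB : x < P.prime 0 ^ B) (j : ℕ) : k j < B := by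
  by_contra hle
  push Not at hle
  have h1 : P.prime 0 ^ B ≤ P.prime 0 ^ k j := pow_le_pow_right₀ P.one_lt.le hle
  have h2 : P.prime 0 ^ k j ≤ P.prime j ^ k j :=
    pow_le_pow_left₀ (P.prime_pos 0).le (P.mono (Nat.zero_le j)) _
  linarith [P.prime_pow_le_genInt k j]

/-- Some power of `λ₀ > 1` exceeds `x`. [folklore] -/
theorem _root_.Literature.Barriers.RiemannHypothesis.BeurlingPrimes.exists_lt_prime_zero_pow (x : ℝ) :
    ∃ B : ℕ, x < P.prime 0 ^ B :=
  pow_unbounded_of_one_lt x P.one_lt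

/-- **Finiteness of the generalized integers up to `x`**: only finitely many exponent vectors `k` satisfy
`∏ λ_j^{k_j} ≤ x` (their supports lie in `{j : λ_j ≤ x}` and their entries are `< B` once `λ₀^B > x`).
[cite: BrouckeDebruyneRevesz2023, §1] -/
theorem _root_.Literature.Barriers.RiemannHypothesis.BeurlingPrimes.finite_setOf_genInt_le (x : ℝ) :
    {k : ℕ →₀ ℕ | P.genInt k ≤ x}.Finite := by
  obtain ⟨B, hB⟩ := P.exists_lt_prime_zero_pow x
  let K₀ : ℕ →₀ ℕ := Finsupp.indicator (Finset.range (P.indexOf x)) fun _ _ ↦ B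
  refine (Finset.Icc 0 K₀).finite_toSet.subset fun k hk ↦ ?_
  simp only [Finset.coe_Icc, Set.mem_Icc, zero_le, true_and]
  change P.genInt k ≤ x at hk
  intro j
  by_cases hj : k j = 0
  · simp [hj]
  · have h2 : j < P.indexOf x := P.prime_le_iff.mp (P.prime_le_of_genInt_le hk hj)
    have h3 : k j < B := P.apply_lt_of_genInt_le hk hB j
    have h4 : K₀ j = B := by
      simp [K₀, Finsupp.indicator_apply, Finset.mem_range, h2]
    rw [h4]
    exact h3.le

/-! ### The integer-counting function `N_P` -/

/-- `N_P(x)` is the (finite) number of exponent vectors `k` with `∏ λ_j^{k_j} ≤ x`. [cite: BrouckeDebruyneRevesz2023, §1] -/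
theorem _root_.Literature.Barriers.RiemannHypothesis.BeurlingPrimes.intCount_eq_ncard (x : ℝ) :
    P.intCount x = {k : ℕ →₀ ℕ | P.genInt k ≤ x}.ncard :=
  Nat.card_coe_set_eq _

/-- `N_P` is non-decreasing. [folklore] -/
theorem _root_.Literature.Barriers.RiemannHypothesis.BeurlingPrimes.intCount_mono : Monotone P.intCount := by
  intro x y hxy
  rw [P.intCount_eq_ncard, P.intCount_eq_ncard]
  exact Set.ncard_le_ncard (fun k hk ↦ le_trans (show P.genInt k ≤ x from hk) hxy)
    (P.finite_setOf_genInt_le y)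

/-- `N_P` jumps at every generalized integer: `N_P(x) < N_P(n)` for `x < n = ∏ λ_j^{k_j}`. [folklore] -/
theorem _root_.Literature.Barriers.RiemannHypothesis.BeurlingPrimes.intCount_lt_intCount_genInt {x : ℝ}
    {k : ℕ →₀ ℕ} (h : x < P.genInt k) : P.intCount x < P.intCount (P.genInt k) := by
  rw [P.intCount_eq_ncard, P.intCount_eq_ncard]
  refine Set.ncard_lt_ncard ⟨fun k' hk' ↦ le_trans (show P.genInt k' ≤ x from hk') h.le, ?_⟩
    (P.finite_setOf_genInt_le _)
  intro hsub
  have : P.genInt k ≤ x := hsub (show P.genInt k ≤ P.genInt k from le_rfl)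
  linarith

/-- `N_P(x) ≥ 1` for `x ≥ 1` (the empty product). [folklore] -/
theorem _root_.Literature.Barriers.RiemannHypothesis.BeurlingPrimes.one_le_intCount {x : ℝ} (hx : 1 ≤ x) :
    1 ≤ P.intCount x := by
  rw [P.intCount_eq_ncard, Nat.one_le_iff_ne_zero, Ne, Set.ncard_eq_zero (P.finite_setOf_genInt_le x)]
  intro h
  have : (0 : ℕ →₀ ℕ) ∈ {k : ℕ →₀ ℕ | P.genInt k ≤ x} := by simp [hx]
  rw [h] at this
  exact this

/-- `N_P(x) = 0` for `x < 1` (every generalized integer is `≥ 1`). [folklore] -/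
theorem _root_.Literature.Barriers.RiemannHypothesis.BeurlingPrimes.intCount_eq_zero_of_lt_one {x : ℝ}
    (hx : x < 1) : P.intCount x = 0 := by
  rw [P.intCount_eq_ncard, Set.ncard_eq_zero (P.finite_setOf_genInt_le x)]
  ext k
  simp only [Set.mem_setOf_eq, Set.mem_empty_iff_false, iff_false, not_le]
  exact lt_of_lt_of_le hx (P.one_le_genInt k)

/-- `genInt (single j m) = λ_j^m`; in particular every prime `λ_j` is a generalized integer. [folklore] -/
@[simp] theorem _root_.Literature.Barriers.RiemannHypothesis.BeurlingPrimes.genInt_single (j m : ℕ) :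
    P.genInt (Finsupp.single j m) = P.prime j ^ m := by
  unfold BeurlingPrimes.genInt
  exact Finsupp.prod_single_index (pow_zero _)

/-! ### The jump of `ψ_P` at a prime -/

/-- **`ψ_P` jumps by `log λ_j` at the prime `λ_j`**: `log λ_j ≤ ψ_P(λ_j) − ψ_P(x)` for `x < λ_j`. [folklore] -/
theorem _root_.Literature.Barriers.RiemannHypothesis.BeurlingPrimes.log_prime_le_chebyshevPsi_sub {x : ℝ} {j : ℕ}
    (h : x < P.prime j) : Real.log (P.prime j) ≤ P.chebyshevPsi (P.prime j) - P.chebyshevPsi x := by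
  classical
  set s : Finset (ℕ × ℕ) := P.psiSupport x ∪ P.psiSupport (P.prime j) with hs
  rw [P.chebyshevPsi_eq_sum_of_subset (Finset.subset_union_right (s₁ := P.psiSupport x)),
    P.chebyshevPsi_eq_sum_of_subset (Finset.subset_union_left (s₂ := P.psiSupport (P.prime j))),
    ← Finset.sum_sub_distrib]
  have hmem : (j, 0) ∈ s :=
    Finset.mem_union_right _ (P.mem_psiSupport (jk := (j, 0)) (by simp))
  refine le_trans ?_ (Finset.single_le_sum (f := fun jk : ℕ × ℕ ↦ P.psiTerm (P.prime j) jk - P.psiTerm x jk)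
    (fun jk _ ↦ sub_nonneg.mpr (P.psiTerm_mono h.le jk)) hmem)
  simp [BeurlingPrimes.psiTerm, not_le.mpr h]

/-! ### Error classes: monotonicity in the exponent and failure at negative exponents -/

/-- `N_P(x) = ax + O(x^γ)` implies `N_P(x) = ax + O(x^{γ'})` for `γ ≤ γ'` (bounds on `x ≥ 1`). [folklore] -/
theorem _root_.Literature.Barriers.RiemannHypothesis.BeurlingPrimes.IntErrorLE.of_le {a γ γ' : ℝ}
    (h : P.IntErrorLE a γ) (hle : γ ≤ γ') : P.IntErrorLE a γ' := by
  obtain ⟨C, hC⟩ := h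
  have hC0 : 0 ≤ C := by simpa using (abs_nonneg _).trans (hC 1 le_rfl)
  exact ⟨C, fun x hx ↦ (hC x hx).trans
    (mul_le_mul_of_nonneg_left (Real.rpow_le_rpow_of_exponent_le hx hle) hC0)⟩

/-- `ψ_P(x) = x + O(x^γ)` implies `ψ_P(x) = x + O(x^{γ'})` for `γ ≤ γ'` (bounds on `x ≥ 1`). [folklore] -/
theorem _root_.Literature.Barriers.RiemannHypothesis.BeurlingPrimes.PrimeErrorLE.of_le {γ γ' : ℝ}
    (h : P.PrimeErrorLE γ) (hle : γ ≤ γ') : P.PrimeErrorLE γ' := by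
  obtain ⟨C, hC⟩ := h
  have hC0 : 0 ≤ C := by simpa using (abs_nonneg _).trans (hC 1 le_rfl)
  exact ⟨C, fun x hx ↦ (hC x hx).trans
    (mul_le_mul_of_nonneg_left (Real.rpow_le_rpow_of_exponent_le hx hle) hC0)⟩

/-- `C x^γ → 0` as `x → ∞` for `γ < 0`: eventually `C x^γ < c` for every `c > 0`. [folklore] -/
theorem eventually_const_mul_rpow_lt {γ : ℝ} (hγ : γ < 0) (C : ℝ) {c : ℝ} (hc : 0 < c) :
    ∀ᶠ x : ℝ in atTop, C * x ^ γ < c := by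
  have h : Tendsto (fun x : ℝ ↦ C * x ^ γ) atTop (𝓝 (C * 0)) := by
    have := (tendsto_rpow_neg_atTop (show 0 < -γ by linarith)).const_mul C
    simpa only [neg_neg] using this
  rw [mul_zero] at h
  exact h.eventually (gt_mem_nhds hc)

/-- **No discrete system has `N_P(x) = ax + O(x^γ)` with `γ < 0`**: `N_P` jumps by `≥ 1` at the primes
`λ_j → ∞` while `ax ± Cx^γ` varies by `< 1` across the jump. [folklore] -/
theorem _root_.Literature.Barriers.RiemannHypothesis.BeurlingPrimes.not_intErrorLE_of_neg {a γ : ℝ} (hγ : γ < 0) :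
    ¬ P.IntErrorLE a γ := by
  rintro ⟨C, hC⟩
  -- beyond `X₀`, `C x^γ < 1/4`
  obtain ⟨X₀, hX₀⟩ := (eventually_const_mul_rpow_lt hγ C (show (0 : ℝ) < 1 / 4 by norm_num)).exists_forall_of_atTop
  obtain ⟨j, hj⟩ := P.exists_lt_prime (max X₀ 1 + 1)
  set n := P.prime j with hn
  set η : ℝ := min (1 / 2) (1 / (4 * (|a| + 1))) with hη
  have hη0 : 0 < η := lt_min (by norm_num) (by positivity)
  have hη1 : η ≤ 1 / 2 := min_le_left _ _
  have hη2 : |a| * η ≤ 1 / 4 := by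
    have h1 : η ≤ 1 / (4 * (|a| + 1)) := min_le_right _ _
    have h2 : |a| * η ≤ |a| * (1 / (4 * (|a| + 1))) := mul_le_mul_of_nonneg_left h1 (abs_nonneg a)
    have h3 : |a| * (1 / (4 * (|a| + 1))) ≤ 1 / 4 := by
      rw [mul_one_div, div_le_div_iff₀ (by positivity) (by norm_num)]
      nlinarith [abs_nonneg a]
    linarith
  set x := n - η with hx
  have hx1 : 1 ≤ x := by
    have : max X₀ 1 + 1 - η ≤ x := by rw [hx]; linarith
    linarith [le_max_right X₀ 1]
  have hxX : X₀ ≤ x := by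
    have : max X₀ 1 + 1 - η ≤ x := by rw [hx]; linarith
    linarith [le_max_left X₀ 1]
  have hxn : x < n := by rw [hx]; linarith
  have hn1 : 1 ≤ n := hx1.trans hxn.le
  -- the jump
  have hjump : P.intCount x + 1 ≤ P.intCount n := by
    have := P.intCount_lt_intCount_genInt (k := Finsupp.single j 1) (x := x) (by simpa [hn] using hxn)
    simpa [hn] using this
  have hjump' : (1 : ℝ) ≤ (P.intCount n : ℝ) - (P.intCount x : ℝ) := by
    have : ((P.intCount x + 1 : ℕ) : ℝ) ≤ (P.intCount n : ℝ) := by exact_mod_cast hjump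
    push_cast at this
    linarith
  -- the two error bounds
  have h1 := hC n hn1
  have h2 := hC x hx1
  have h3 : C * n ^ γ < 1 / 4 := hX₀ n (hxX.trans hxn.le)
  have h4 : C * x ^ γ < 1 / 4 := hX₀ x hxX
  have h5 : (P.intCount n : ℝ) - (P.intCount x : ℝ)
      = ((P.intCount n : ℝ) - a * n) - ((P.intCount x : ℝ) - a * x) + a * η := by rw [hx]; ring
  have h6 : a * η ≤ 1 / 4 := (le_abs_self _).trans (by rw [abs_mul, abs_of_pos hη0]; exact hη2)
  have h7 := abs_le.mp (h1.trans h3.le)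
  have h8 := abs_le.mp (h2.trans h4.le)
  linarith [h7.2, h8.1]

/-- **No discrete system has `ψ_P(x) = x + O(x^γ)` with `γ < 0`**: `ψ_P` jumps by `≥ log λ₀ > 0` at the primes
`λ_j → ∞` while `x ± Cx^γ` varies by less across the jump. [folklore] -/
theorem _root_.Literature.Barriers.RiemannHypothesis.BeurlingPrimes.not_primeErrorLE_of_neg {γ : ℝ} (hγ : γ < 0) :
    ¬ P.PrimeErrorLE γ := by
  rintro ⟨C, hC⟩
  have hL : 0 < Real.log (P.prime 0) := Real.log_pos P.one_lt
  obtain ⟨X₀, hX₀⟩ := (eventually_const_mul_rpow_lt hγ C (show 0 < Real.log (P.prime 0) / 4 by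
    positivity)).exists_forall_of_atTop
  obtain ⟨j, hj⟩ := P.exists_lt_prime (max X₀ 1 + 1)
  set n := P.prime j with hn
  set η : ℝ := min (1 / 2) (Real.log (P.prime 0) / 4) with hη
  have hη0 : 0 < η := lt_min (by norm_num) (by positivity)
  have hη1 : η ≤ 1 / 2 := min_le_left _ _
  have hη2 : η ≤ Real.log (P.prime 0) / 4 := min_le_right _ _
  set x := n - η with hx
  have hx1 : 1 ≤ x := by
    have : max X₀ 1 + 1 - η ≤ x := by rw [hx]; linarith
    linarith [le_max_right X₀ 1]
  have hxX : X₀ ≤ x := by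
    have : max X₀ 1 + 1 - η ≤ x := by rw [hx]; linarith
    linarith [le_max_left X₀ 1]
  have hxn : x < n := by rw [hx]; linarith
  have hn1 : 1 ≤ n := hx1.trans hxn.le
  have hjump : Real.log (P.prime 0) ≤ P.chebyshevPsi n - P.chebyshevPsi x :=
    (Real.log_le_log (P.prime_pos 0) (P.mono (Nat.zero_le j))).trans (P.log_prime_le_chebyshevPsi_sub hxn)
  have h1 := hC n hn1
  have h2 := hC x hx1
  have h3 : C * n ^ γ < Real.log (P.prime 0) / 4 := hX₀ n (hxX.trans hxn.le)
  have h4 : C * x ^ γ < Real.log (P.prime 0) / 4 := hX₀ x hxX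
  have h5 : P.chebyshevPsi n - P.chebyshevPsi x
      = (P.chebyshevPsi n - n) - (P.chebyshevPsi x - x) + η := by rw [hx]; ring
  have h7 := abs_le.mp (h1.trans h3.le)
  have h8 := abs_le.mp (h2.trans h4.le)
  linarith [h7.2, h8.1]

end Literature.NumberTheory.BeurlingPrimes
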